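import Summits.AtomisticToContinuum.BoseEinsteinCondensation.Theorems.BECGroundStateSOSPeriodicIRBoundTwoSectorKato
import Summits.AtomisticToContinuum.BoseEinsteinCondensation.Theorems.PeriodicIRBound.Negative.FreeGas
import Summits.AtomisticToContinuum.BoseEinsteinCondensation.Theorems.FibreConductance.Negative.FreeConstantFlow
import HarnessLib

/-!
# Route `BECGroundStateSOS`, crux `PeriodicIRBound` (stmt-AtomisticToContinuum-3972), line `two-sector-gd-transfer` —
# the FREE-GAS instances of the two pooled stubs S1 (`GaussianDomination`, stmt-12620) and S2 (`EnergyConvexityWindow`, stmt-9094)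

Supports (does not close) stmt-AtomisticToContinuum-3972. The registered skeleton `Cruxes/PeriodicIRBound/Lines/two_sector_gd_transfer.lean`
has exactly three `sorry`s: S1 `GaussianDomination` (= stmt-AtomisticToContinuum-12620, per potential `GDFor v K ρ₀ C`), S2
`EnergyConvexityWindow` (= stmt-AtomisticToContinuum-9094, per potential `ConvexityFor v`) and the scope half S6. This file
kernel-checks both pooled blockers on the one exactly solvable member of the admissible class, the free gas `v = 0`
(`isRepulsiveFiniteRange_zero`, `∫ 0 = 0 ≠ ⊤`), against the TYPED statements with the genuine one-particle transfer term —
the consistency half of a refuter pass on S1/S2 (earlier passes elaborated only the degenerate instances `t = 0`, `p = 0`, `p = 1`):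

* §1 `FreeGas.transfer_sq_le_occupation` (Cauchy–Schwarz on the cell:
  `(√(N+1)·I(Ψ,Φ))² = (Re⟨Ψ, a(φ_n)Φ⟩)² ≤ ‖a(φ_n)Φ‖² = n_n(Φ)`, sharpening `Kato.transfer_sq_le`'s `≤ N+1`),
  `FreeGas.kinetic_mode_le` (per-mode kinetic Markov in `ℝ`: `(4π²|n|₂²/L²)·n_n(Φ) ≤ E(Φ)` at `v = 0`), `FreeGas.core`
  (the discriminant: `(1−p)·ε·m − 2|t|√(p(1−p))·|M| ≥ −t²/ε` when `M² ≤ m`, `ε m ≤ E_Φ`).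
* §2 `FreeGas.inner_zero` — the body of `GDFor 0` at EVERY `(N, L, n ≠ 0, t, p)` with constant `C ≥ 1/(4π²)`: no window `K`, no
  diluteness `ρ₀`, no threshold `t₀`, no `∀ᶠ N` is used — all four guards of stmt-12620 are idle at `v = 0` (as the crux's are,
  `Negative.irBoundWith_zero`); `gdFor_zero : GDFor 0 K ρ₀ C` for all `K, ρ₀` and `C ≥ 1/(4π²)`, and the `v = 0` instance of the body of
  stmt-12620, `exists_gdFor_zero`. The free two-sector susceptibility is `1/ε_n = L²/(4π²|n|₂²) ≤ L²/(4π²‖n‖_∞²)`, so `1/(4π²)` is the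
  natural constant in the sup-norm normalisation of the item.
* §3 `convexityFor_zero : ConvexityFor 0` (`E₀^{per}(v = 0) ≡ 0`, `periodicGroundStateEnergy_zero_eq_zero`) and the joint statement
  `pooledStubs_zero`: the residual `S1 ∧ S2` of the line holds on the free gas — neither pooled blocker admits a hypothesis-free refutation,
  and the line's reduction `integrableHalf_of` is non-vacuous there.

References: T. Kennedy, E. H. Lieb, B. S. Shastry, J. Stat. Phys. 53 (1988) 1019, (12)–(14), (18); F. J. Dyson, E. H. Lieb, B. Simon,
J. Stat. Phys. 18 (1978) 335, §1 (Gaussian domination ⇒ susceptibility bound; the free Bose gas saturates it with `b = 1/ε`).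
-/

noncomputable section

open scoped BigOperators ENNReal ComplexConjugate
open Filter MeasureTheory

namespace Summit.AtomisticToContinuum.BoseEinsteinCondensation.Cruxes.PeriodicIRBound.TwoSectorGdTransfer

open Literature.MathematicalPhysics.QuantumManyBody.BoseGas
open Summit.AtomisticToContinuum.BoseEinsteinCondensation.Cruxes.PeriodicIRBound.LinearPhFloorWagner
open Summit.AtomisticToContinuum.BoseEinsteinCondensation.Theorems.PeriodicIRBound.Negative
  (fracDispersion_mul_cellOccupation_le fracDispersion_two_nsq one_le_nsq)
open Summit.AtomisticToContinuum.BoseEinsteinCondensation.Theorems.GaussianDominationCan.Negative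
  (nsq nsq_nonneg one_le_norm_intVec isRepulsiveFiniteRange_zero)
open Summit.AtomisticToContinuum.BoseEinsteinCondensation.Theorems.FibreConductance.Negative (norm_sq_le_nsq)

namespace FreeGas

/-! ## §1 Inputs: the transfer bound `M² ≤ n_n(Φ)`, per-mode kinetic Markov, and the discriminant
(`‖n‖_∞² ≤ |n|₂²` is the tree's `FibreConductance.Negative.norm_sq_le_nsq`) -/

/-- **Transfer bound**: `(√(N+1)·I(Ψ,Φ))² = (Re⟨Ψ, a(φ_n)Φ⟩)² ≤ ‖Ψ‖²·‖a(φ_n)Φ‖² = n_n(Φ)` for normalised periodic trial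
states (Cauchy–Schwarz on the cell, `‖a(φ_n)Φ‖² = n_n(Φ)` by `WF.normSq_modeAn`; the proof is `Kato.transfer_sq_le`'s without its
last step `n_n(Φ) ≤ N+1`). [cite: LSSY2005, App. A (A.11), (A.13)] -/
theorem transfer_sq_le_occupation {N : ℕ} {L : ℝ} (hL : 0 < L) (n : Fin 3 → ℤ) (Ψ : PeriodicTrialState N L)
    (Φ : PeriodicTrialState (N + 1) L) :
    (Real.sqrt ((N : ℝ) + 1) * transferIntegralRe L n Ψ.ψ Φ.ψ) ^ 2 ≤
      (cellOccupation (N + 1) L (planeWaveMode L n) Φ.ψ).toReal := by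
  -- adapted from `Kato.transfer_sq_le` (Theorems/BECGroundStateSOSPeriodicIRBoundTwoSectorKato.lean)
  rw [sqrt_mul_transferIntegralRe]
  set g := modeAn L (planeWaveMode L n) Φ.ψ with hg
  have hΨc : Continuous Ψ.ψ := Ψ.contDiff.continuous
  have hΦc : Continuous Φ.ψ := Φ.contDiff.continuous
  have hgc : Continuous g := WF.continuous_modeAn L (continuous_planeWaveMode L n) hΦc
  have hΨ1 : (∫⁻ X in cellN N L, ((‖Ψ.ψ X‖₊ : ℝ≥0∞)) ^ 2) = 1 := Ψ.norm_eq
  have hgocc : (∫⁻ X in cellN N L, ((‖g X‖₊ : ℝ≥0∞)) ^ 2) = cellOccupation (N + 1) L (planeWaveMode L n) Φ.ψ := by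
    rw [hg, ← WF.normSq_modeAn hL n Φ.ψ]
    rfl
  have hg2 : (∫⁻ X in cellN N L, ((‖g X‖₊ : ℝ≥0∞)) ^ 2) ≤ ((N + 1 : ℕ) : ℝ≥0∞) := by
    have h1 : WF.normSq L g ≤ ((N + 1 : ℕ) : ℝ≥0∞) * WF.normSq L Φ.ψ := by
      rw [hg, WF.normSq_modeAn hL n Φ.ψ]
      exact WF.cellOccupation_le_mul_normSq hL n hΦc
    have h2 : WF.normSq L Φ.ψ = 1 := Φ.norm_eq
    rw [h2, mul_one] at h1
    exact h1
  have hg2' : (∫⁻ X in cellN N L, ((‖g X‖₊ : ℝ≥0∞)) ^ 2) ≠ ⊤ :=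
    ne_top_of_le_ne_top (ENNReal.natCast_ne_top _) hg2
  have hCS := Kato.norm_integral_conj_mul_le L hΨc hgc (by rw [hΨ1]; exact ENNReal.one_ne_top) hg2'
  rw [hΨ1, ENNReal.toReal_one, Real.sqrt_one, one_mul] at hCS
  set I := ∫ X in cellN N L, conj (Ψ.ψ X) * g X with hI
  have hre : |I.re| ≤ ‖I‖ := Complex.abs_re_le_norm I
  calc I.re ^ 2 ≤ ‖I‖ ^ 2 := sq_le_sq' (abs_le.1 hre).1 (abs_le.1 hre).2
    _ ≤ Real.sqrt ((∫⁻ X in cellN N L, ((‖g X‖₊ : ℝ≥0∞)) ^ 2).toReal) ^ 2 :=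
        pow_le_pow_left₀ (norm_nonneg _) hCS 2
    _ = (∫⁻ X in cellN N L, ((‖g X‖₊ : ℝ≥0∞)) ^ 2).toReal := Real.sq_sqrt ENNReal.toReal_nonneg
    _ = (cellOccupation (N + 1) L (planeWaveMode L n) Φ.ψ).toReal := by rw [hgocc]

/-- **Per-mode kinetic Markov bound at `v = 0`, over `ℝ`**: `(4π²|n|₂²/L²)·n_n(Φ) ≤ E(Φ)` for a finite-energy periodic state
(`Negative.fracDispersion_mul_cellOccupation_le`, one term of the Parseval gradient identity). [folklore] -/
theorem kinetic_mode_le {N : ℕ} {L : ℝ} (hL : 0 < L) (n : Fin 3 → ℤ) (Φ : PeriodicTrialState N L)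
    (hΦ : periodicEnergy 0 Φ ≠ ⊤) :
    4 * Real.pi ^ 2 * nsq n / L ^ 2 * (cellOccupation N L (planeWaveMode L n) Φ.ψ).toReal ≤
      (periodicEnergy 0 Φ).toReal := by
  have h := fracDispersion_mul_cellOccupation_le hL 0 Φ n
  rw [fracDispersion_two_nsq] at h
  have h' := ENNReal.toReal_mono hΦ h
  rwa [ENNReal.toReal_mul,
    ENNReal.toReal_ofReal (div_nonneg (mul_nonneg (by positivity) (nsq_nonneg n)) (sq_nonneg L))] at h'

/-- **The discriminant (real-arithmetic core)**: if `0 ≤ p ≤ 1`, `ε > 0`, `M² ≤ m`, `ε·m ≤ E_Φ`, `0 ≤ E_Ψ` and `1/ε ≤ C'`, then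
`−C' t² ≤ p E_Ψ + (1−p) E_Φ + 2t√(p(1−p))·M` — complete the square
`ε p(1−p) M² + 2t√(p(1−p)) M + t²/ε = (ε√(p(1−p))M + t)²/ε ≥ 0` and use `p(1−p) ≤ 1 − p`. [folklore] -/
theorem core {p t M m ε EΨ EΦ C' : ℝ} (hp0 : 0 ≤ p) (hp1 : p ≤ 1) (hε : 0 < ε) (hM : M ^ 2 ≤ m)
    (hEΦ : ε * m ≤ EΦ) (hEΨ : 0 ≤ EΨ) (hC : 1 / ε ≤ C') :
    -(C' * t ^ 2) ≤ p * EΨ + (1 - p) * EΦ + 2 * t * Real.sqrt (p * (1 - p)) * M := by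
  set s := Real.sqrt (p * (1 - p)) with hs
  have h1p : 0 ≤ 1 - p := by linarith
  have hs2 : s ^ 2 = p * (1 - p) := Real.sq_sqrt (mul_nonneg hp0 h1p)
  have hs2le : s ^ 2 ≤ 1 - p := by rw [hs2]; nlinarith
  have hm : 0 ≤ m := le_trans (sq_nonneg M) hM
  have h1 : ε * s ^ 2 * M ^ 2 ≤ (1 - p) * EΦ := by
    have hsm : s ^ 2 * M ^ 2 ≤ (1 - p) * m := mul_le_mul hs2le hM (sq_nonneg M) h1p
    calc ε * s ^ 2 * M ^ 2 = ε * (s ^ 2 * M ^ 2) := by ring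
      _ ≤ ε * ((1 - p) * m) := mul_le_mul_of_nonneg_left hsm hε.le
      _ = (1 - p) * (ε * m) := by ring
      _ ≤ (1 - p) * EΦ := mul_le_mul_of_nonneg_left hEΦ h1p
  have h2 : 0 ≤ ε * s ^ 2 * M ^ 2 + 2 * t * s * M + t ^ 2 / ε := by
    have : ε * s ^ 2 * M ^ 2 + 2 * t * s * M + t ^ 2 / ε = (ε * s * M + t) ^ 2 / ε := by
      field_simp
      ring
    rw [this]
    positivity
  have h3 : t ^ 2 / ε ≤ C' * t ^ 2 := by
    have := mul_le_mul_of_nonneg_left hC (sq_nonneg t)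
    calc t ^ 2 / ε = t ^ 2 * (1 / ε) := by ring
      _ ≤ t ^ 2 * C' := this
      _ = C' * t ^ 2 := by ring
  have h4 : 0 ≤ p * EΨ := mul_nonneg hp0 hEΨ
  nlinarith [h1, h2, h3, h4]

/-! ## §2 S1 on the free gas: `GDFor 0 K ρ₀ C` for all `K`, `ρ₀` and every `C ≥ 1/(4π²)` -/

/-- **The body of two-sector Gaussian domination at `v = 0`, at EVERY `(N, L, n ≠ 0, t, p)`** with `C ≥ 1/(4π²)`:
`p·E₀(N) + (1−p)·E₀(N+1) − C t² L²/‖n‖_∞² ≤ p·E(Ψ) + (1−p)·E(Φ) + 2t√(p(1−p))·√(N+1)·I(Ψ,Φ)` for all finite-energy `Φ`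
(`E₀ ≡ 0`; the right side is `≥ (1−p)ε_n n_n(Φ) − 2|t|√(p(1−p))√(n_n(Φ)) ≥ −t²/ε_n`, `1/ε_n = L²/(4π²|n|₂²) ≤ L²/(4π²‖n‖_∞²)`).
No momentum window, no density condition, no smallness of `t`. [cite: DLS1978, §1] -/
theorem inner_zero {N : ℕ} {L : ℝ} (hL : 0 < L) {n : Fin 3 → ℤ} (hn : n ≠ 0) {C : ℝ}
    (hC : 1 / (4 * Real.pi ^ 2) ≤ C) (t p : ℝ) (hp0 : 0 ≤ p) (hp1 : p ≤ 1) (Ψ : PeriodicTrialState N L)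
    (Φ : PeriodicTrialState (N + 1) L) (hΦ : periodicEnergy 0 Φ ≠ ⊤) :
    p * (periodicGroundStateEnergy 0 N L).toReal +
          (1 - p) * (periodicGroundStateEnergy 0 (N + 1) L).toReal -
        C * t ^ 2 * L ^ 2 / ‖(fun j => (n j : ℝ))‖ ^ 2 ≤
      p * (periodicEnergy 0 Ψ).toReal + (1 - p) * (periodicEnergy 0 Φ).toReal +
        2 * t * Real.sqrt (p * (1 - p)) * Real.sqrt ((N : ℝ) + 1) * transferIntegralRe L n Ψ.ψ Φ.ψ := by
  have e0 : (periodicGroundStateEnergy 0 N L).toReal = 0 := by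
    rw [periodicGroundStateEnergy_zero_eq_zero N hL, ENNReal.toReal_zero]
  have e1 : (periodicGroundStateEnergy 0 (N + 1) L).toReal = 0 := by
    rw [periodicGroundStateEnergy_zero_eq_zero (N + 1) hL, ENNReal.toReal_zero]
  rw [e0, e1, mul_zero, mul_zero, zero_add, zero_sub]
  have hn1 : 1 ≤ ‖(fun j => (n j : ℝ))‖ := one_le_norm_intVec hn
  have hnsq : ‖(fun j => (n j : ℝ))‖ ^ 2 ≤ nsq n := norm_sq_le_nsq n
  have hnsq1 : 1 ≤ nsq n := one_le_nsq hn
  have hπ : (0 : ℝ) < 4 * Real.pi ^ 2 := by positivity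
  set ε : ℝ := 4 * Real.pi ^ 2 * nsq n / L ^ 2 with hε
  have hεpos : 0 < ε := div_pos (mul_pos hπ (by linarith)) (pow_pos hL 2)
  have hCε : 1 / ε ≤ C * L ^ 2 / ‖(fun j => (n j : ℝ))‖ ^ 2 := by
    have hns0 : (0 : ℝ) < ‖(fun j => (n j : ℝ))‖ ^ 2 := by positivity
    calc 1 / ε = L ^ 2 / (4 * Real.pi ^ 2 * nsq n) := by
          rw [hε]
          field_simp
      _ ≤ L ^ 2 / (4 * Real.pi ^ 2 * ‖(fun j => (n j : ℝ))‖ ^ 2) :=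
          div_le_div_of_nonneg_left (sq_nonneg L) (mul_pos hπ hns0)
            (mul_le_mul_of_nonneg_left hnsq hπ.le)
      _ = 1 / (4 * Real.pi ^ 2) * (L ^ 2 / ‖(fun j => (n j : ℝ))‖ ^ 2) := by
          field_simp
      _ ≤ C * (L ^ 2 / ‖(fun j => (n j : ℝ))‖ ^ 2) := mul_le_mul_of_nonneg_right hC (by positivity)
      _ = C * L ^ 2 / ‖(fun j => (n j : ℝ))‖ ^ 2 := by ring
  have hcore := core (t := t) hp0 hp1 hεpos (transfer_sq_le_occupation hL n Ψ Φ) (kinetic_mode_le hL n Φ hΦ)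
    (ENNReal.toReal_nonneg : 0 ≤ (periodicEnergy 0 Ψ).toReal) hCε
  have hmul : C * t ^ 2 * L ^ 2 / ‖(fun j => (n j : ℝ))‖ ^ 2 =
      C * L ^ 2 / ‖(fun j => (n j : ℝ))‖ ^ 2 * t ^ 2 := by ring
  have hassoc : 2 * t * Real.sqrt (p * (1 - p)) * Real.sqrt ((N : ℝ) + 1) * transferIntegralRe L n Ψ.ψ Φ.ψ =
      2 * t * Real.sqrt (p * (1 - p)) * (Real.sqrt ((N : ℝ) + 1) * transferIntegralRe L n Ψ.ψ Φ.ψ) := by ring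
  rw [hmul, hassoc]
  linarith [hcore]

/-- **S1 on the free gas**: `GDFor 0 K ρ₀ C` for ALL `K, ρ₀ ∈ ℝ` and every `C ≥ 1/(4π²)` (threshold `t₀ := 1`, unused). So the typed
two-sector Gaussian domination (stmt-AtomisticToContinuum-12620, per potential) holds on the free gas with all four of its guards idle.
[cite: DLS1978, §1] -/
theorem gdFor_zero (K ρ₀ : ℝ) {C : ℝ} (hC : 1 / (4 * Real.pi ^ 2) ≤ C) : GDFor 0 K ρ₀ C := by
  refine Filter.Eventually.of_forall fun N L hL _ n hn _ => ⟨1, one_pos, fun t _ p hp0 hp1 Ψ Φ _ hΦ => ?_⟩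
  exact inner_zero hL hn hC t p hp0 hp1 Ψ Φ hΦ

/-- **The `v = 0` instance of the body of stmt-AtomisticToContinuum-12620** (`gaussianDomination_iff`): the free gas is admissible
(`isRepulsiveFiniteRange_zero`), integrable (`∫ 0 = 0`), and has Gaussian-domination data `(K, ρ₀, C) = (1, 1, 1/(4π²))`. [cite: DLS1978, §1] -/
theorem exists_gdFor_zero : ∃ K : ℝ, 0 < K ∧ ∃ ρ₀ : ℝ, 0 < ρ₀ ∧ ∃ C : ℝ, 0 < C ∧ GDFor 0 K ρ₀ C :=
  ⟨1, one_pos, 1, one_pos, 1 / (4 * Real.pi ^ 2), by positivity, gdFor_zero 1 1 le_rfl⟩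

/-! ## §3 S2 on the free gas, and the residual `S1 ∧ S2` of the line at `v = 0` -/

/-- **S2 on the free gas**: `ConvexityFor 0` — `E₀^{per}(v = 0, N, L) = 0` for every `N` and `L > 0`, so midpoint convexity holds
with room `ε√(ρa)/L ≥ 0` (any `ρ₁`, here `ρ₁ := 1`). [folklore] -/
theorem convexityFor_zero : ConvexityFor 0 := by
  refine ⟨1, one_pos, fun ε _ ρ _ _ => Filter.Eventually.of_forall fun N L hL _ _ => ?_⟩
  rw [periodicGroundStateEnergy_zero_eq_zero N hL, periodicGroundStateEnergy_zero_eq_zero (N + 1) hL,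
    periodicGroundStateEnergy_zero_eq_zero (N - 1) hL, mul_zero, zero_add]
  exact zero_le

/-- **The pooled residual of line `two-sector-gd-transfer` holds on the free gas**: the `v = 0` instances of S1 (body of stmt-12620)
and S2 (body of stmt-9094, `energyConvexityWindow_iff`) — neither pooled blocker of the crux admits a hypothesis-free refutation, and
the line's reduction `integrableHalf_of` is non-vacuous on the admissible class. [folklore] -/
theorem pooledStubs_zero :
    IsRepulsiveFiniteRange (0 : ℝ → ℝ≥0∞) ∧ (∫⁻ x : Space, (0 : ℝ → ℝ≥0∞) ‖x‖) ≠ ⊤ ∧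
      (∃ K : ℝ, 0 < K ∧ ∃ ρ₀ : ℝ, 0 < ρ₀ ∧ ∃ C : ℝ, 0 < C ∧ GDFor 0 K ρ₀ C) ∧ ConvexityFor 0 :=
  ⟨isRepulsiveFiniteRange_zero, by simp, exists_gdFor_zero, convexityFor_zero⟩

end FreeGas

/-- **Registered by-product stub `stub_freeGasPooledStubs` of the crux ledger** (line `two-sector-gd-transfer`, lead seat c21): the pooled
residual S1 ∧ S2 of the registered skeleton holds on the free gas — `v = 0` is admissible and integrable, the body of stmt-12620 holds for it
with data `(K, ρ₀, C) = (1, 1, 1/(4π²))`, and the body of stmt-9094 holds for it (`FreeGas.pooledStubs_zero`). [folklore] -/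
theorem stub_freeGasPooledStubs : Literature.MathematicalPhysics.QuantumManyBody.BoseGas.IsRepulsiveFiniteRange (0 : ℝ → ENNReal) ∧ (∫⁻ x : EuclideanSpace ℝ (Fin 3), (0 : ℝ → ENNReal) ‖x‖) ≠ ⊤ ∧ (∃ K : ℝ, 0 < K ∧ ∃ ρ₀ : ℝ, 0 < ρ₀ ∧ ∃ C : ℝ, 0 < C ∧ Summit.AtomisticToContinuum.BoseEinsteinCondensation.Cruxes.PeriodicIRBound.TwoSectorGdTransfer.GDFor 0 K ρ₀ C) ∧ Summit.AtomisticToContinuum.BoseEinsteinCondensation.Cruxes.PeriodicIRBound.TwoSectorGdTransfer.ConvexityFor 0 :=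
  FreeGas.pooledStubs_zero

end Summit.AtomisticToContinuum.BoseEinsteinCondensation.Cruxes.PeriodicIRBound.TwoSectorGdTransfer

end
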